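import Summits.BirchSwinnertonDyer.BirchSwinnertonDyer.Theorems.GenusKolyvaginAtTwoK4NegPhantomFrameTraceBit
import Literature.NumberTheory.EllipticCurves.HeegnerPointsKolyvaginEulerSystem
import Literature.NumberTheory.EllipticCurves.HeegnerPointsOfConductor
import HarnessLib

/-!
# Route `GenusKolyvaginAtTwo`, crux K₄⁻ `K4Neg` (stmt-BirchSwinnertonDyer-31526), the (β)-residual F4ᶠ —
# THE DEEP-PRIME ONE-BIT LAW for quarter-points of an entangled half (file 1 of 2)

Width seat `bsd-line-gk2-p5` g43 (cell `bsd-f1-sign2`), WIDTH-5 attach on route `GenusKolyvaginAtTwo` rev 59, lane «the (β)-residual of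
K₄⁻».  `--supports stmt-BirchSwinnertonDyer-31526 --as helper`.  THEOREMS ONLY (no definition, no named fact, no `sorry`); standard axioms.
**BSD is NOT proved by this file; `K4Neg` is NOT proved; no item is closed by it.**

WHY.  After LEAD g28/g29 (`…K4NegOfWallRowsU2HalvingBit`, `…K4NegOfWallRowsU2AlphaOrNonPhantom`), gk2-p3 g34 (`…PhantomCellDescentBit*`)
and gk2-p4 g34/g35 (`…PhantomFrameTraceBit`, `…EntangledIffTrace`), K₄⁻ at a prime Heegner frame `K = ℚ(√−ℓ₀)` follows from WALL + U₂ + Q2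
+ PRINT unless the frame is a **(β)-frame**: the Lawson–Wuthrich class `ξ_E ∈ Sel₂(E)` and `4 ∣ a_{ℓ₀}(E)`, equivalently the twin's
generator `R` has a half `Q'` fixed by `Γ_{K(E[4])}` that is not `K`-rational (`hHalf` fails; LINE 37 stub P / F4ᶠ, director (677):
«one bit short», disprover-wanted).  This file puts «one bit short» in the kernel as statements about POINTS of `E(ℚ̄)` under `Γ_ℚ`
(dictionary: for a deep Kolyvagin prime `ℓ` with arithmetic Frobenius `g` — `g` acts on `E[2]` as complex conjugation and `g·g` fixes
`E[4]` — the point `g·g·Q − Q` IS the localisation at `λ = ℓ𝓞_K` of the level-`4` Kummer class of `R` with root `Q`, read in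
`H¹_ur(K_λ, E[4]) = E[4]/(Frob_λ − 1) = E[4]`, `Frob_λ = g·g`):

* §0 `𝔽₂²`-algebra (`decide`) and its transport: the fixed points on `E[2]` of an element acting as a transposition are `{0, e + g·e}`.
* §1 ★ **ONE-BIT LAW** (`sq_smul_sub_eq_zero_or_eq_of_smul_eq_neg` / `…_of_smul_eq_self`).  `g ∈ Γ_ℚ` with `g·g = 1` on `E[4]` and
  `g ≠ 1` on `E[2]`; `R ∈ E(ℚ̄)` with `g·R = −R` (resp. `g·R = R`); `Q'` a half of `R` with `g·g·Q' = Q'` (the ENTANGLED half of a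
  (β)-frame: `g·g ∈ Γ_{K(E[4])}`); `Q` a half of `Q'`.  Then **`g·g·Q − Q ∈ {0, e + g·e}`** — ONE bit, for every quarter-point of the
  entangled half, at every deep prime.  (Proof: with `t = g·Q ± Q ∈ E[4]`, `g·g·Q − Q = ∓(t − g·t)` is `g`-anti-fixed resp. `g`-fixed,
  and killed by `2`; §0.)  The vanishing `2·(g·g·Q − Q) = g·g·Q' − Q' = 0` is gk2-p4's trace bit `loc_λ ι(res_K ξ_E) = 0`; the surviving
  bit is the TOP bit of the level-`4` Kummer class.
* §2 The frame dictionary: `sq_smul_eq_self_of_four_dvd` (`4 ∣ a_ℓ`, `4 ∣ ℓ + 1` ⟹ `Fr·Fr = 1` on `E[4]`, Cayley–Hamilton of gk2-p4's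
  TraceBit §1), `sq_smul_eq_self_of_two_le_kolyvaginIndex` (the K4Neg binder `2 ≤ kolyvaginIndex W 2 ℓ`), and ★★★
  `deepPrime_oneBit_of_frobEqFrobInfty`: at every deep `FrobEqFrobInfty` Kolyvagin prime of a `Δ < 0` curve the Frobenius datum `h` of
  the tree's `FrobEqFrobInfty` satisfies the hypotheses of §1, so the one-bit law holds there verbatim.
File 2 (`…K4NegBetaFrameDeepPrimeTopBit`): the flip law along `g·Γ_{ℚ(E[4],Q')}` and «both bit values occur» (top-bit visibility).

READING (census of the (β) residual; nothing closed).  On a (β)-frame every class of `Sel₄(E/K)` has a phantom-or-zero double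
(`2·Sel₄ ⊆ {0, ι res_K ξ_E}` at `M₀ = 1`), so by §1 the WHOLE level-`4` Selmer group localises into ONE bit at every deep prime; what NO
deep prime supplies is the first Kolyvagin step (`[c(ℓ)]_s ↔ loc_λ c(1) = loc_λ ι ξ_E = 0`), which is why K4Neg|(β) is neither proved nor
refuted by descent.  BSD is NOT proved by any of this.

References: [GrossLMS1991] §3 (3.2)–(3.3), §4 Prop. 4.1, §9 Prop. 9.1, 9.6; [McCallumLMS1991] §3 (2)–(3), §4 Prop. 4.4; [LawsonWuthrich2016]
§3 (Lemma 6, Thm. 1), §7.1; [WZhang2014] Notations (xii); [SilvermanAEC2009] Thm. V.2.3.1, Cor. III.6.4, VIII.§2.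
-/

set_option linter.dupNamespace false -- `Summit.<P>.<Sub>` repeats `BirchSwinnertonDyer` (D-0017)
set_option autoImplicit false

noncomputable section

open scoped Classical Pointwise

namespace Summit.BirchSwinnertonDyer.BirchSwinnertonDyer.Theorems.GenusExact.Lw2PhantomExclusion.DeepPrimeOneBit

open WeierstrassCurve Field NumberField IsDedekindDomain Matrix
open Literature.NumberTheory.GaloisRepresentations Literature.NumberTheory.EllipticCurves
open Literature.NumberTheory
open Rat.HeightOneSpectrum (primesEquiv)
open Summit.BirchSwinnertonDyer.BirchSwinnertonDyer.Theorems.GenusKolyTwistingPrime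

/-! ## §0 `𝔽₂²`-algebra: the fixed points of a transposition -/

/-- **`𝔽₂²`: the fixed vectors of an involution `M` moving `w` are `0` and `w + Mw`.** [folklore] -/
theorem twoByTwo_fixed_eq_zero_or_eq_add :
    ∀ (M : Matrix (Fin 2) (Fin 2) (ZMod 2)) (v w : Fin 2 → ZMod 2), M * M = 1 → M *ᵥ v = v → M *ᵥ w ≠ w →
      v = 0 ∨ v = w + M *ᵥ w := by
  decide

variable (W : WeierstrassCurve ℚ) [W.IsElliptic]

/-- **Fixed points of a transposition-type element on `E[2]`.**  If `g ∈ Γ_ℚ` acts on `E[2]` as an involution moving `e`, then every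
`g`-fixed `T ∈ E[2]` is `0` or `e + g·e` (`#E[2] = 4`; a frame `E[2] ≃ 𝔽₂²` and §0). [cite: SilvermanAEC2009, Cor. III.6.4(b)] -/
theorem torsionTwo_fixed_eq_zero_or_eq_add {g : absoluteGaloisGroup ℚ}
    (hgg : ∀ T : geomTorsion W (2 : ℤ), g • g • T = T) {e : geomTorsion W (2 : ℤ)} (hge : g • e ≠ e)
    (T : geomTorsion W (2 : ℤ)) (hT : g • T = T) : T = 0 ∨ T = e + g • e := by
  haveI : Fact (Nat.Prime 2) := ⟨Nat.prime_two⟩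
  have h2T : ∀ P : geomTorsion W (2 : ℤ), 2 • P = 0 := fun P ↦ AddSubgroup.torsionBy.nsmul P
  have hcard : Nat.card (geomTorsion W (2 : ℤ)) = 2 ^ 2 := natCard_geomTorsion_two_rat W
  obtain ⟨ε⟩ := KolyvaginImage.nonempty_addEquiv_of_card_eq_sq h2T hcard
  obtain ⟨M, hM⟩ : ∃ M : Matrix (Fin 2) (Fin 2) (ZMod 2), ∀ T : geomTorsion W (2 : ℤ), ε (g • T) = M *ᵥ ε T := by
    refine ⟨LinearMap.toMatrix' ((ε.toAddMonoidHom.comp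
      ((DistribSMul.toAddMonoidHom (geomTorsion W (2 : ℤ)) g).comp ε.symm.toAddMonoidHom)).toZModLinearMap 2),
      fun T ↦ ?_⟩
    rw [← Matrix.toLin'_apply, Matrix.toLin'_toMatrix']
    simp
  have hMM : M * M = 1 := by
    refine Matrix.toLin'.injective (LinearMap.ext fun w ↦ ?_)
    rw [Matrix.toLin'_mul, LinearMap.comp_apply, Matrix.toLin'_apply, Matrix.toLin'_apply, Matrix.toLin'_one,
      LinearMap.id_apply]
    have h := hM (g • ε.symm w)
    rw [hgg, ε.apply_symm_apply, hM, ε.apply_symm_apply] at h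
    exact h.symm
  have hv : M *ᵥ ε T = ε T := by rw [← hM, hT]
  have hw : M *ᵥ ε e ≠ ε e := by
    intro h
    apply hge
    apply ε.injective
    rw [hM, h]
  rcases twoByTwo_fixed_eq_zero_or_eq_add M _ _ hMM hv hw with h0 | h1
  · left
    apply ε.injective
    rw [h0, map_zero]
  · right
    apply ε.injective
    rw [h1, map_add, hM]

omit [W.IsElliptic] in
/-- In `E(ℚ̄)`: a point killed by `2` is its own negative. [folklore] -/
theorem neg_eq_self_of_two_zsmul_eq_zero {P : geomPoints W} (hP : (2 : ℤ) • P = 0) : -P = P := by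
  rw [two_zsmul] at hP
  exact neg_eq_of_add_eq_zero_left hP

/-- **Fixed points of a transposition-type element on `E[2]`, for points of `E(ℚ̄)` killed by `2`** (§0 transported).  Here `g·g` is
only required to fix the points killed by `2`. [cite: SilvermanAEC2009, Cor. III.6.4(b)] -/
theorem two_torsion_fixed_eq_zero_or_eq_add {g : absoluteGaloisGroup ℚ}
    (hgg : ∀ P : geomPoints W, (2 : ℤ) • P = 0 → g • g • P = P)
    {e : geomPoints W} (he : (2 : ℤ) • e = 0) (hge : g • e ≠ e)
    {P : geomPoints W} (hP : (2 : ℤ) • P = 0) (hgP : g • P = P) : P = 0 ∨ P = e + g • e := by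
  have heT : e ∈ geomTorsion W (2 : ℤ) := (WeierstrassCurve.mem_geomTorsion_iff W (2 : ℤ) e).mpr he
  have hPT : P ∈ geomTorsion W (2 : ℤ) := (WeierstrassCurve.mem_geomTorsion_iff W (2 : ℤ) P).mpr hP
  have hgg' : ∀ T : geomTorsion W (2 : ℤ), g • g • T = T := fun T ↦ by
    apply Subtype.ext
    rw [AddSubgroup.torsionBy.coe_smul, AddSubgroup.torsionBy.coe_smul]
    exact hgg _ ((WeierstrassCurve.mem_geomTorsion_iff W (2 : ℤ) _).mp T.2)
  have hge' : g • (⟨e, heT⟩ : geomTorsion W (2 : ℤ)) ≠ ⟨e, heT⟩ := fun h ↦ hge (by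
    have := congrArg Subtype.val h
    simpa only [AddSubgroup.torsionBy.coe_smul] using this)
  have hT : g • (⟨P, hPT⟩ : geomTorsion W (2 : ℤ)) = ⟨P, hPT⟩ := Subtype.ext (by
    rw [AddSubgroup.torsionBy.coe_smul]; exact hgP)
  rcases torsionTwo_fixed_eq_zero_or_eq_add W hgg' hge' ⟨P, hPT⟩ hT with h0 | h1
  · exact Or.inl (by simpa using congrArg Subtype.val h0)
  · right
    have := congrArg Subtype.val h1
    simpa only [AddMemClass.coe_add, AddSubgroup.torsionBy.coe_smul] using this

/-! ## §1 ★ THE ONE-BIT LAW for quarter-points of an entangled half -/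

omit [W.IsElliptic] in
/-- `2·(g·g·Q − Q) = g·g·Q' − Q' = 0` for a half `Q` of a point `Q'` fixed by `g·g` — the «blind» bit (gk2-p4's trace bit: `loc_λ` of the
double vanishes). [cite: LawsonWuthrich2016, §3] -/
theorem two_zsmul_sq_smul_sub_eq_zero {g : absoluteGaloisGroup ℚ} {Q Q' : geomPoints W}
    (hQ : (2 : ℤ) • Q = Q') (hgQ' : g • g • Q' = Q') : (2 : ℤ) • (g • g • Q - Q) = 0 := by
  rw [zsmul_sub, smul_comm (2 : ℤ) g (g • Q), smul_comm (2 : ℤ) g Q, hQ, hgQ', sub_self]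

omit [W.IsElliptic] in
/-- **The localisation bit is `g`-FIXED (minus case).**  `g·g = 1` on `E[4]`, `g·R = −R`, `2Q' = R`, `g·g·Q' = Q'`, `2Q = Q'` ⟹
`g·(g·g·Q − Q) = g·g·Q − Q`.  (With `t := g·Q + Q ∈ E[4]`: `g·g·Q − Q = g·t − t` is `g`-ANTI-fixed and killed by `2`.)
[cite: GrossLMS1991, §4 Prop. 4.1] -/
theorem smul_sq_smul_sub_of_smul_eq_neg {g : absoluteGaloisGroup ℚ}
    (hg4 : ∀ P : geomPoints W, (4 : ℤ) • P = 0 → g • g • P = P)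
    {R Q' Q : geomPoints W} (hR : g • R = -R) (hQ' : (2 : ℤ) • Q' = R) (hQ : (2 : ℤ) • Q = Q')
    (hgQ' : g • g • Q' = Q') : g • (g • g • Q - Q) = g • g • Q - Q := by
  -- `t := g·Q + Q` is killed by `4`
  have h4Q : (4 : ℤ) • Q = R := by
    rw [show (4 : ℤ) = 2 * 2 by norm_num, mul_smul, hQ, hQ']
  have ht4 : (4 : ℤ) • (g • Q + Q) = 0 := by
    rw [smul_add, smul_comm (4 : ℤ) g Q, h4Q, hR, neg_add_cancel]
  have hggt : g • g • (g • Q + Q) = g • Q + Q := hg4 _ ht4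
  -- `y := g·g·Q − Q = g·t − t`
  have hy : g • g • Q - Q = g • (g • Q + Q) - (g • Q + Q) := by
    rw [smul_add]; abel
  -- `g·y = g·g·t − g·t = t − g·t = −y`
  have hgy : g • (g • g • Q - Q) = -(g • g • Q - Q) := by
    rw [hy, smul_sub, hggt]; abel
  -- and `2y = 0`, so `−y = y`
  rw [hgy, neg_eq_self_of_two_zsmul_eq_zero W (two_zsmul_sq_smul_sub_eq_zero W hQ hgQ')]

omit [W.IsElliptic] in
/-- **The localisation bit is `g`-FIXED (plus case).**  `g·g = 1` on `E[4]`, `g·R = R`, `2Q' = R`, `2Q = Q'` ⟹ `g·(g·g·Q − Q) =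
g·g·Q − Q` (with `t := g·Q − Q ∈ E[4]`: `g·g·Q − Q = t + g·t`). [cite: GrossLMS1991, §4 Prop. 4.1] -/
theorem smul_sq_smul_sub_of_smul_eq_self {g : absoluteGaloisGroup ℚ}
    (hg4 : ∀ P : geomPoints W, (4 : ℤ) • P = 0 → g • g • P = P)
    {R Q' Q : geomPoints W} (hR : g • R = R) (hQ' : (2 : ℤ) • Q' = R) (hQ : (2 : ℤ) • Q = Q') :
    g • (g • g • Q - Q) = g • g • Q - Q := by
  have h4Q : (4 : ℤ) • Q = R := by
    rw [show (4 : ℤ) = 2 * 2 by norm_num, mul_smul, hQ, hQ']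
  have ht4 : (4 : ℤ) • (g • Q - Q) = 0 := by
    rw [smul_sub, smul_comm (4 : ℤ) g Q, h4Q, hR, sub_self]
  have hggt : g • g • (g • Q - Q) = g • Q - Q := hg4 _ ht4
  have hy : g • g • Q - Q = (g • Q - Q) + g • (g • Q - Q) := by
    rw [smul_sub]; abel
  rw [hy, smul_add, hggt, add_comm]

/-- ★ **THE ONE-BIT LAW (minus case).**  `g ∈ Γ_ℚ` with `g·g = 1` on `E[4]` and `g·e ≠ e` for some `e ∈ E[2]` (the Frobenius of a DEEP
Kolyvagin prime: §3); `R ∈ E(ℚ̄)` with `g·R = −R` (a point of the minus part, e.g. the twin's generator read in `E`); `Q'` a half of `R` with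
`g·g·Q' = Q'` (an ENTANGLED half: fixed by `Γ_{K(E[4])} ∋ g·g`); `Q` a half of `Q'`.  Then **`g·g·Q − Q = 0` or `g·g·Q − Q = e + g·e`**:
the localisation of the level-`4` Kummer class of `R` at the deep prime is ONE BIT. [cite: GrossLMS1991, §4 Prop. 4.1, §9 Prop. 9.6]
[cite: LawsonWuthrich2016, §3, §7.1] -/
theorem sq_smul_sub_eq_zero_or_eq_of_smul_eq_neg {g : absoluteGaloisGroup ℚ}
    (hg4 : ∀ P : geomPoints W, (4 : ℤ) • P = 0 → g • g • P = P)
    {e : geomPoints W} (he : (2 : ℤ) • e = 0) (hge : g • e ≠ e)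
    {R Q' Q : geomPoints W} (hR : g • R = -R) (hQ' : (2 : ℤ) • Q' = R) (hQ : (2 : ℤ) • Q = Q')
    (hgQ' : g • g • Q' = Q') : g • g • Q - Q = 0 ∨ g • g • Q - Q = e + g • e := by
  have hgg : ∀ P : geomPoints W, (2 : ℤ) • P = 0 → g • g • P = P := fun P hP ↦
    hg4 P (by rw [show (4 : ℤ) = 2 * 2 by norm_num, mul_smul, hP, smul_zero])
  exact two_torsion_fixed_eq_zero_or_eq_add W hgg he hge (two_zsmul_sq_smul_sub_eq_zero W hQ hgQ')
    (smul_sq_smul_sub_of_smul_eq_neg W hg4 hR hQ' hQ hgQ')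

/-- ★ **THE ONE-BIT LAW (plus case)**: the same with `g·R = R` (e.g. `R` rational on the twin, the law read on the twin's own points) and
`g·g·Q' = Q'`. [cite: GrossLMS1991, §4 Prop. 4.1, §9 Prop. 9.6] [cite: LawsonWuthrich2016, §3, §7.1] -/
theorem sq_smul_sub_eq_zero_or_eq_of_smul_eq_self {g : absoluteGaloisGroup ℚ}
    (hg4 : ∀ P : geomPoints W, (4 : ℤ) • P = 0 → g • g • P = P)
    {e : geomPoints W} (he : (2 : ℤ) • e = 0) (hge : g • e ≠ e)
    {R Q' Q : geomPoints W} (hR : g • R = R) (hQ' : (2 : ℤ) • Q' = R) (hQ : (2 : ℤ) • Q = Q')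
    (hgQ' : g • g • Q' = Q') : g • g • Q - Q = 0 ∨ g • g • Q - Q = e + g • e := by
  have hgg : ∀ P : geomPoints W, (2 : ℤ) • P = 0 → g • g • P = P := fun P hP ↦
    hg4 P (by rw [show (4 : ℤ) = 2 * 2 by norm_num, mul_smul, hP, smul_zero])
  exact two_torsion_fixed_eq_zero_or_eq_add W hgg he hge (two_zsmul_sq_smul_sub_eq_zero W hQ hgQ')
    (smul_sq_smul_sub_of_smul_eq_self W hg4 hR hQ' hQ)

/-! ## §2 The frame dictionary: deep Kolyvagin primes satisfy the hypotheses -/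

section Frame

variable [W.IsGloballyMinimal]

/-- **`4 ∣ a_ℓ` and `4 ∣ ℓ + 1` ⟹ `Fr·Fr = 1` on `E[4]`** for an arithmetic Frobenius `Fr` at a good odd place `v = (ℓ)`: Cayley–Hamilton
`Fr²P = a_ℓ·FrP − ℓ·P` (gk2-p4 `TraceBit.frob_smul_frob_smul_eq_of_four_smul_eq_zero`) with `a_ℓ·FrP = 0` and `ℓ·P = −P` on `E[4]`.
This is the index-`≥ 2` («deep») condition of the K₄⁻ witness primes. [cite: SilvermanAEC2009, Thm. V.2.3.1] [cite: GrossLMS1991, §3 (3.3)] -/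
theorem sq_smul_eq_self_of_four_dvd {v : HeightOneSpectrum (𝓞 ℚ)}
    (hne : ((primesEquiv v : Nat.Primes) : ℕ) ≠ 2) (hv : W.HasGoodReductionAt v)
    {Fr : absoluteGaloisGroup ℚ} (hFr : IsArithFrobAtPlace ℚ v Fr)
    (ha : (4 : ℤ) ∣ W.frobeniusTrace (primesEquiv v)) (hℓ : 4 ∣ ((primesEquiv v : Nat.Primes) : ℕ) + 1)
    (P : geomPoints W) (hP : (4 : ℤ) • P = 0) : Fr • Fr • P = P := by
  have hCH := PhantomDescentBit.TraceBit.frob_smul_frob_smul_eq_of_four_smul_eq_zero W hne hv hFr hP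
  obtain ⟨a', ha'⟩ := ha
  obtain ⟨c', hc'⟩ := hℓ
  have hq : (((primesEquiv v : Nat.Primes) : ℕ) : ℤ) = 4 * (c' : ℤ) - 1 := by
    have := congrArg (fun n : ℕ ↦ (n : ℤ)) hc'
    push_cast at this
    linarith
  have h4FP : (4 : ℤ) • Fr • P = 0 := by rw [smul_comm, hP, smul_zero]
  rw [hCH, ha', hq, mul_comm (4 : ℤ) a', mul_smul, h4FP, smul_zero, sub_smul, mul_comm (4 : ℤ) (c' : ℤ), mul_smul, hP,
    smul_zero, one_smul]
  abel

/-- **The K4Neg binder `2 ≤ kolyvaginIndex W 2 ℓ` ⟹ `Fr·Fr = 1` on `E[4]`** at a good odd prime `ℓ` (`kolyvaginIndex = min(v₂(ℓ+1), v₂(a_ℓ))`,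
Zhang 2014 Notations (xii), tree `Zhang2014.le_kolyvaginIndex_iff`). [cite: WZhang2014, Notations (xii)] [cite: SilvermanAEC2009, Thm. V.2.3.1] -/
theorem sq_smul_eq_self_of_two_le_kolyvaginIndex {ℓ : ℕ} (hℓ : ℓ.Prime) (hℓ2 : ℓ ≠ 2) (hℓN : ¬ ℓ ∣ W.conductorNorm ℤ)
    (hdeep : 2 ≤ Zhang2014.kolyvaginIndex W 2 ℓ)
    {v : HeightOneSpectrum (𝓞 ℚ)} (hℓv : (ℓ : 𝓞 ℚ) ∈ v.asIdeal) {𝔓 : Ideal (absIntegers (𝓞 ℚ) ℚ)} (h𝔓 : 𝔓 ∈ v.primesAbove)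
    {Fr : absoluteGaloisGroup ℚ} (hFr : IsArithFrobAt (𝓞 ℚ) Fr 𝔓)
    (P : geomPoints W) (hP : (4 : ℤ) • P = 0) : Fr • Fr • P = P := by
  haveI : Fact (Nat.Prime 2) := ⟨Nat.prime_two⟩
  have hv : (primesEquiv v : ℕ) = ℓ := primesEquiv_eq hℓ hℓv
  have hW : W.HasGoodReductionAt v := by
    by_contra h
    exact hℓN (hv ▸ (W.dvd_conductorNorm_iff v).mpr h)
  have hne : ((primesEquiv v : Nat.Primes) : ℕ) ≠ 2 := by rw [hv]; exact hℓ2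
  obtain ⟨h1, h2⟩ := (Zhang2014.le_kolyvaginIndex_iff (W := W) (p := 2) (M := 2) (ℓ := ℓ)).mp hdeep
  have ha : (4 : ℤ) ∣ W.frobeniusTrace (primesEquiv v) := by
    rw [hv]; exact_mod_cast h2
  have hℓ4 : 4 ∣ ((primesEquiv v : Nat.Primes) : ℕ) + 1 := by
    rw [hv]; exact_mod_cast h1
  exact sq_smul_eq_self_of_four_dvd W hne hW ⟨𝔓, h𝔓, hFr⟩ ha hℓ4 P hP

/-- ★★★ **AT A DEEP `FrobEqFrobInfty` KOLYVAGIN PRIME THE ONE-BIT LAW HOLDS VERBATIM.**  `W/ℚ` globally minimal with `Δ < 0`; `ℓ` a Kolyvagin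
prime at `2` for the Heegner field `K` (tree `Zhang2014.IsKolyvaginPrime`) of index `≥ 2` with `Frob_ℓ = Frob_∞` (tree `FrobEqFrobInfty`) —
exactly the witness primes of the route item `K4Neg`.  Then the Frobenius `h` of the `FrobEqFrobInfty` datum has `h·h = 1` on `E[4]` (§3)
and moves a point of `E[2]` (it acts there as a complex conjugation, a transposition since `Δ < 0`), so for every `R` with `h·R = −R`, every
half `Q'` of `R` fixed by `h·h`, every half `Q` of `Q'`: **`h·h·Q − Q ∈ {0, e + h·e}`** with `e ∈ E[2]`, `h·e ≠ e`.  READING: the deep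
primes of K4Neg see ONE bit of the entangled half's quarter-points (the top bit of the level-`4` Kummer class), never the phantom bottom bit.
BSD / `K4Neg` NOT proved by this. [cite: GrossLMS1991, §3 (3.2)–(3.3), §9 Prop. 9.6] [cite: WZhang2014, Notations (xii)]
[cite: LawsonWuthrich2016, §3, §7.1] -/
theorem deepPrime_oneBit_of_frobEqFrobInfty (hΔ : W.Δ < 0)
    {K : Type} [Field K] [NumberField K] {ℓ : ℕ}
    (hKoly : Zhang2014.IsKolyvaginPrime (W.conductorNorm ℤ) W K 2 ℓ) (hdeep : 2 ≤ Zhang2014.kolyvaginIndex W 2 ℓ)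
    (hFrob : FrobEqFrobInfty W K 2 ℓ) :
    ∃ (h : absoluteGaloisGroup ℚ) (e : geomPoints W),
      (∃ (v : HeightOneSpectrum (𝓞 ℚ)) (𝔓 : Ideal (absIntegers (𝓞 ℚ) ℚ)),
          (ℓ : 𝓞 ℚ) ∈ v.asIdeal ∧ 𝔓 ∈ v.primesAbove ∧ IsArithFrobAt (𝓞 ℚ) h 𝔓) ∧
      (∀ P : geomPoints W, (4 : ℤ) • P = 0 → h • h • P = P) ∧ (2 : ℤ) • e = 0 ∧ h • e ≠ e ∧
      ∀ (R Q' Q : geomPoints W), h • R = -R → (2 : ℤ) • Q' = R → (2 : ℤ) • Q = Q' → h • h • Q' = Q' →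
        h • h • Q - Q = 0 ∨ h • h • Q - Q = e + h • e := by
  obtain ⟨hℓ, hℓN, -, hℓ2, -, -⟩ := hKoly
  obtain ⟨v, 𝔓, h, c₀, hℓv, h𝔓, hh, hc₀, hhc₀, -⟩ := hFrob
  have hg4 : ∀ P : geomPoints W, (4 : ℤ) • P = 0 → h • h • P = P :=
    sq_smul_eq_self_of_two_le_kolyvaginIndex W hℓ hℓ2 hℓN hdeep hℓv h𝔓 hh
  -- `h` acts on `E[2]` as `c₀`, which moves a `2`-torsion point since `Δ < 0`
  obtain ⟨e, he⟩ := KolyvaginEigenTwo.exists_twoTorsion_smul_ne_of_Δ_neg W hΔ hc₀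
  have hhe : h • (e : geomPoints W) ≠ e := by
    intro hcon
    apply he
    rw [← hhc₀ e]
    exact Subtype.ext (by rw [AddSubgroup.torsionBy.coe_smul]; exact hcon)
  have he2 : (2 : ℤ) • (e : geomPoints W) = 0 := (WeierstrassCurve.mem_geomTorsion_iff W (2 : ℤ) _).mp e.2
  exact ⟨h, e, ⟨v, 𝔓, hℓv, h𝔓, hh⟩, hg4, he2, hhe, fun R Q' Q hR hQ' hQ hgQ' ↦
    sq_smul_sub_eq_zero_or_eq_of_smul_eq_neg W hg4 he2 hhe hR hQ' hQ hgQ'⟩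

end Frame

end Summit.BirchSwinnertonDyer.BirchSwinnertonDyer.Theorems.GenusExact.Lw2PhantomExclusion.DeepPrimeOneBit

end
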